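import Summits.AtomisticToContinuum.FouriersLaw.Theorems.BondHeatUncertaintyLightConeBondHeatTentStatics
import Summits.AtomisticToContinuum.FouriersLaw.Theorems.BondHeatUncertaintyLightConeBondHeatWindowedTransfer

/-!
# `NonBallistic` from sub-ballistic block transport of the open chain

Support file for item `stmt-AtomisticToContinuum-9123` (`BondHeatUncertainty.LightConeBondHeat`, (S_lc)), fourth part of
the bulk-bond (tent) reduction: the tent reduction with `N`-uniform statics (`…LightConeBondHeatTentStatics`) composed with the
windowed transfer (`…LightConeBondHeatWindowedTransfer`).  Any `N`-uniform gain over the ballistic size of the block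
functional of the OPEN chain, `V_N^J(t) ≤ C t^α (L+1)` with `α < 2`, gives a single-time windowed law with exponent
`θ = α/2 < 1` at bond `0` (tent length `⌊N^{α/2}⌋`, time `t = N`), hence the NonBallistic rung of the route through (K) and
(★).  (`α = 1` is the diffusive ceiling of `lightConeBondHeat_of_openBlockDiffusion`, which gives (S_lc) itself.)
Nothing here closes an item.
-/

noncomputable section

open MeasureTheory Filter Topology Set intervalIntegral
open scoped NNReal ENNReal

namespace Summit.AtomisticToContinuum.FouriersLaw.Theorems.LightConeBondHeat

open Literature.MathematicalPhysics.KineticTheory.HeatConduction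
open Literature.MathematicalPhysics.KineticTheory Literature.Probability.Process OscillatorChain
open Summit.AtomisticToContinuum.FouriersLaw.Theorems.SubBallisticWindow.Negative.ClosedFlow
open Summit.AtomisticToContinuum.FouriersLaw.Theorems.SubdiffusiveBondHeat
open Summit.AtomisticToContinuum.FouriersLaw.Theses.BondHeatUncertainty

/-- **`NonBallistic` from `N`-uniform SUB-BALLISTIC block transport of the open chain.**  If for the pinned anharmonic
chain (all parameters `> 0`) and every `T > 0` there are `C` and an exponent `1 ≤ α < 2` with
`V_N^J(t) ≤ C t^α (L+1)` for every `N`, every block of bonds `[b₀, b₀+L]` with `b₀ + L + 1 < N` and every `t ≥ 1` (any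
`N`-uniform gain over the ballistic size `α = 2` of the block functional), then
`ExtensiveSnapshotIrreversibility → LinearResponseFTUR → NessUnique → NonBallistic`: the tent reduction with tent length
`⌊t^{α/2}⌋` at bond `0` and time `t = N` gives the single-time windowed law `V_N(0, N) ≤ (2C⁺ + 16c⁺) N^{α/2}` for
`N ≥ max(3, 2^{1/(1-α/2)})`, and `θ = α/2 < 1` feeds `nonBallistic_of_windowed_bondHeat`
(`…LightConeBondHeatWindowedTransfer`). [folklore] -/
theorem nonBallistic_of_openBlockSubballistic
    (hD : ∀ ω₂ lam β γ : ℝ, 0 < ω₂ → 0 < lam → 0 < β → 0 < γ → ∀ T : ℝ, 0 < T → ∃ C α : ℝ, 1 ≤ α ∧ α < 2 ∧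
      ∀ (N b₀ L : ℕ), b₀ + L + 1 < N → ∀ t : ℝ, 1 ≤ t →
        2 * ∫ s in (0 : ℝ)..t, (t - s) *
          ∫ z, (∑ k : Fin N, (if b₀ ≤ k.val ∧ k.val ≤ b₀ + L then (pinnedChain ω₂ lam β γ).bondCurrent N k z else 0)) *
            (∫ y, (∑ k : Fin N, (if b₀ ≤ k.val ∧ k.val ≤ b₀ + L then (pinnedChain ω₂ lam β γ).bondCurrent N k y else 0))
              ∂((pinnedChain ω₂ lam β γ).transitionKernel N T T s.toNNReal z))
            ∂((pinnedChain ω₂ lam β γ).gibbsMeasure N T) ≤ C * t ^ α * ((L : ℝ) + 1)) :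
    ExtensiveSnapshotIrreversibility → LinearResponseFTUR → NessUnique → NonBallistic := by
  refine fun hK hF hU => nonBallistic_of_windowed_bondHeat ?_ hK hF hU
  intro ω₂ lam β γ hω hl hβ hγ T hT
  simp only []
  obtain ⟨C, α, hα1, hα2, hC⟩ := hD ω₂ lam β γ hω hl hβ hγ T hT
  obtain ⟨c, hc⟩ := pinnedChain_tentEnergy_variance_le hω hl.le hβ.le γ hT
  set C' : ℝ := max C 0 with hC'
  set c' : ℝ := max c 0 with hc'
  have hC'0 : 0 ≤ C' := le_max_right _ _
  have hc'0 : 0 ≤ c' := le_max_right _ _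
  set θ : ℝ := α / 2 with hθ
  have hθ1 : θ < 1 := by rw [hθ]; linarith
  have hθ0 : 0 ≤ θ := by rw [hθ]; linarith
  have h1θ : 0 < 1 - θ := by linarith
  -- threshold: `N ≥ X₀ = 2^{1/(1-θ)}` gives `N^{1-θ} ≥ 2`, i.e. `N^θ ≤ N/2`
  set X₀ : ℝ := (2 : ℝ) ^ (1 - θ)⁻¹ with hX₀
  have hX₀0 : 0 ≤ X₀ := Real.rpow_nonneg (by norm_num) _
  have hX₀pow : X₀ ^ (1 - θ) = 2 := by
    rw [hX₀]; exact Real.rpow_inv_rpow (by norm_num) h1θ.ne'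
  obtain ⟨M₀, hM₀⟩ := exists_nat_ge X₀
  refine ⟨θ, 2 * C' + 16 * c', fun N => 1 * (N : ℝ), hθ1, tendsto_lightCone_window one_pos hθ1, max 3 M₀,
    fun N hN => ?_⟩
  have hN3 : 3 ≤ N := le_trans (le_max_left _ _) hN
  have hNM₀ : M₀ ≤ N := le_trans (le_max_right _ _) hN
  have hN3r : (3 : ℝ) ≤ (N : ℝ) := by exact_mod_cast hN3
  have hNpos : (0 : ℝ) < (N : ℝ) := by linarith
  have hN1 : (1 : ℝ) ≤ (N : ℝ) := by linarith
  refine ⟨by simp only [one_mul]; exact hNpos, 0, by omega, ?_⟩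
  simp only [one_mul]
  -- `N^θ ≤ N/2`
  have hNθ : (N : ℝ) ^ θ ≤ (N : ℝ) / 2 := by
    have hXN : X₀ ≤ (N : ℝ) := hM₀.trans (by exact_mod_cast hNM₀)
    have h2 : (2 : ℝ) ≤ (N : ℝ) ^ (1 - θ) := by
      rw [← hX₀pow]; exact Real.rpow_le_rpow hX₀0 hXN h1θ.le
    have hsplit : (N : ℝ) = (N : ℝ) ^ θ * (N : ℝ) ^ (1 - θ) := by
      rw [← Real.rpow_add hNpos]; norm_num
    have hθpos : 0 ≤ (N : ℝ) ^ θ := Real.rpow_nonneg hNpos.le _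
    rw [le_div_iff₀ (by norm_num : (0:ℝ) < 2)]
    calc (N : ℝ) ^ θ * 2 ≤ (N : ℝ) ^ θ * (N : ℝ) ^ (1 - θ) := mul_le_mul_of_nonneg_left h2 hθpos
      _ = (N : ℝ) := hsplit.symm
  -- the block length `L = ⌊N^θ⌋`
  set L : ℕ := ⌊(N : ℝ) ^ θ⌋₊ with hL
  have hθpos : 0 ≤ (N : ℝ) ^ θ := Real.rpow_nonneg hNpos.le _
  have hLle : (L : ℝ) ≤ (N : ℝ) ^ θ := Nat.floor_le hθpos
  have hLlt : (N : ℝ) ^ θ < (L : ℝ) + 1 := Nat.lt_floor_add_one _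
  have h1le : (1 : ℝ) ≤ (N : ℝ) ^ θ := Real.one_le_rpow hN1 hθ0
  have hbL : 0 + L + 1 < N := by
    have h1 : (L : ℝ) + 1 < (N : ℝ) := by linarith
    have h2 : L + 1 < N := by exact_mod_cast h1
    omega
  have hN0 : 0 < N := by omega
  simp only [dif_pos hN0]
  -- the tent reduction at bond `0`, time `t = N`
  have key := pinnedChain_bondHeatVar_le_tent hω hl.le hβ hγ hT hbL hNpos.le
    (∫ y, weightedEnergy (pinnedChain ω₂ lam β γ)
      (fun k : ℕ => if 0 < k ∧ k ≤ 0 + L then ((0 : ℕ) + (L : ℝ) + 1 - k) / (L + 1) else 0) N y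
      ∂((pinnedChain ω₂ lam β γ).gibbsMeasure N T))
  have hJ := hC N 0 L hbL (N : ℝ) hN1
  have hW := hc N 0 L
  have hL1 : (0 : ℝ) < (L : ℝ) + 1 := by positivity
  -- `t^α = t^θ · t^θ`
  have hαθ : (N : ℝ) ^ α = (N : ℝ) ^ θ * (N : ℝ) ^ θ := by
    rw [← Real.rpow_add hNpos]; congr 1; rw [hθ]; ring
  -- block term
  have hblock : 2 / ((L : ℝ) + 1) ^ 2 * (C * (N : ℝ) ^ α * ((L : ℝ) + 1)) ≤ 2 * C' * (N : ℝ) ^ θ := by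
    have hα0 : 0 ≤ (N : ℝ) ^ α := Real.rpow_nonneg hNpos.le _
    have h1 : C * (N : ℝ) ^ α * ((L : ℝ) + 1) ≤ C' * (N : ℝ) ^ α * ((L : ℝ) + 1) := by
      apply mul_le_mul_of_nonneg_right _ hL1.le
      exact mul_le_mul_of_nonneg_right (le_max_left _ _) hα0
    have h2 : 2 / ((L : ℝ) + 1) ^ 2 * (C' * (N : ℝ) ^ α * ((L : ℝ) + 1)) = 2 * C' * (N : ℝ) ^ α / ((L : ℝ) + 1) := by
      field_simp
    have h3 : 2 * C' * (N : ℝ) ^ α / ((L : ℝ) + 1) ≤ 2 * C' * (N : ℝ) ^ α / (N : ℝ) ^ θ :=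
      div_le_div_of_nonneg_left (by positivity) (by positivity) hLlt.le
    have h4 : 2 * C' * (N : ℝ) ^ α / (N : ℝ) ^ θ = 2 * C' * (N : ℝ) ^ θ := by
      rw [hαθ]; field_simp
    calc 2 / ((L : ℝ) + 1) ^ 2 * (C * (N : ℝ) ^ α * ((L : ℝ) + 1))
        ≤ 2 / ((L : ℝ) + 1) ^ 2 * (C' * (N : ℝ) ^ α * ((L : ℝ) + 1)) := mul_le_mul_of_nonneg_left h1 (by positivity)
      _ = 2 * C' * (N : ℝ) ^ α / ((L : ℝ) + 1) := h2
      _ ≤ 2 * C' * (N : ℝ) ^ α / (N : ℝ) ^ θ := h3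
      _ = 2 * C' * (N : ℝ) ^ θ := h4
  -- static term
  have hstat : 8 * (c * ((L : ℝ) + 1)) ≤ 16 * c' * (N : ℝ) ^ θ := by
    have h1 : c * ((L : ℝ) + 1) ≤ c' * ((L : ℝ) + 1) := mul_le_mul_of_nonneg_right (le_max_left _ _) hL1.le
    have h2 : (L : ℝ) + 1 ≤ 2 * (N : ℝ) ^ θ := by linarith
    nlinarith [mul_le_mul_of_nonneg_left h2 hc'0]
  have hV := key.trans (add_le_add (mul_le_mul_of_nonneg_left hJ (by positivity)) (mul_le_mul_of_nonneg_left hW (by norm_num)))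
  calc _ ≤ _ := hV
    _ ≤ 2 * C' * (N : ℝ) ^ θ + 16 * c' * (N : ℝ) ^ θ := add_le_add hblock hstat
    _ = (2 * C' + 16 * c') * (N : ℝ) ^ θ := by ring


end Summit.AtomisticToContinuum.FouriersLaw.Theorems.LightConeBondHeat

end
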